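import Literature.NumberTheory.EllipticCurves.FrobeniusTateModule
import Literature.NumberTheory.EllipticCurves.FrobeniusEndomorphism
import Literature.NumberTheory.EllipticCurves.TateModuleDeterminantProofs
import Literature.NumberTheory.EllipticCurves.WeilPairingProofs
import Literature.NumberTheory.EllipticCurves.FrobeniusSeparableProofs
import HarnessLib

/-!
# `tr(φ_ℓ) = q + 1 - #E(k)` and `det(φ_ℓ) = q` (Silverman, *AEC*, Thm. V.2.3.1): reduction of the named facts

Topic `NumberTheory/EllipticCurves` (trunk T-ELLARITH); the `…Proofs` sibling of
`Literature.NumberTheory.EllipticCurves.FrobeniusTateModule`, whose two named facts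

* `WeierstrassCurve.det_galoisRepTate_frobenius W ℓ` (`det(φ_ℓ) = q`) and
* `WeierstrassCurve.trace_galoisRepTate_frobenius W ℓ` (`tr(φ_ℓ) = q + 1 - #E(k)`)

(Silverman, *AEC*, 2nd ed., Thm. V.2.3.1, proof, and Remark V.2.6; `φ_ℓ` the arithmetic Frobenius
`σ_q` on `T_ℓ E`, `ℓ ≠ char k`) are here **reduced to printed inputs lower in the book**, by
assembling the sibling files `FrobeniusEndomorphism` (the isogenies `φ`, `1 - φ`; `T_ℓ(φ) = φ_ℓ`,
`T_ℓ(1 - φ) = 1 - φ_ℓ`, `#ker(1 - φ) = #E(k)`, `tr(A) = 1 + det(A) - det(1 - A)`) and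
`TateModuleDeterminantProofs` (`det(φ_ℓ) = q` from the Weil pairing):

* `det_galoisRepTate_frobenius_of_exists_weilPairing'`: the determinant fact from the Weil
  pairings on `E[ℓ^n]`, `n ≥ 1` (named facts `exists_weilPairing W (ℓ^(n+1))`, *AEC* Prop. III.8.1)
  — Silverman's route is `det(φ_ℓ) = deg φ` (Prop. III.8.6, proved with the Weil pairing)
  `= q` (Prop. II.2.11(c)); that route is `det_galoisRepTate_frobenius_of_deg` (from the named
  facts `Isogeny.det_tateModule_map_eq_deg W ℓ` and `frobeniusIsogeny_deg_eq_card W` of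
  `FrobeniusEndomorphism`).
* `trace_galoisRepTate_frobenius_of_exists_weilPairing`: the trace fact from the Weil pairings
  (for `det(φ_ℓ) = q`), Prop. III.8.6 at `1 - φ` (`det(1 - φ_ℓ) = deg(1 - φ)`, named fact
  `Isogeny.det_tateModule_map_eq_deg W ℓ`), Thm. III.4.10(a) (`#ker = deg_s`, named fact
  `Isogeny.card_ker_eq_finSepDegree W W` of `IsogenyDegree`) and Cor. III.5.5 (`1 - φ` separable,
  named fact `isSeparable_oneSubFrobeniusIsogeny W`): `tr(φ_ℓ) = 1 + det(φ_ℓ) - det(1 - φ_ℓ)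
  = 1 + q - deg(1 - φ) = 1 + q - #ker(1 - φ) = q + 1 - #E(k)` — the printed proofs of
  Thm. V.1.1 and Thm. V.2.3.1; `trace_galoisRepTate_frobenius_of_deg` is the same with II.2.11(c)
  in place of the Weil pairing.

Nothing new is defined. In Part 1, `…_holds` is not asserted for either fact (Prop. III.8.1,
Prop. III.8.6, Thm. III.4.10(a) and Cor. III.5.5 being named facts of the tree at the time).

## Part 2 (appended). The Weil pairing, III.4.10(a) and III.5.5 are now proved

`Literature.NumberTheory.EllipticCurves.WeilPairingProofs` proves Prop. III.8.1
(`WeierstrassCurve.exists_weilPairing_holds`), `…IsogenyDegreeKernelProofs` proves Thm. III.4.10(a)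
(`Isogeny.card_ker_eq_finSepDegree_holds`) and `…FrobeniusSeparableProofs` proves Cor. III.5.5
(`isSeparable_oneSubFrobeniusIsogeny_holds`). Hence **`det_galoisRepTate_frobenius_holds`**
(the determinant fact, unconditionally), `det_galoisRepTate_eq_cyclotomicCharacter_holds`
(`det ρ_{E,ℓ} = χ_ℓ` for every elliptic curve over a perfect field), and
`trace_galoisRepTate_frobenius_of_det_tateModule_map_eq_deg` (the trace fact from Prop. III.8.6
alone).

## References

* [SilvermanAEC2009] J. H. Silverman, *The Arithmetic of Elliptic Curves*, 2nd ed., GTM 106,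
  Springer 2009: Prop. II.2.11(c), Thm. III.4.10(a), Cor. III.5.5, Prop. III.8.1, Prop. III.8.6,
  Thm. V.1.1 (proof, PDF p. 126), Thm. V.2.3.1 (proof, PDF p. 130), Remark V.2.6.
-/

noncomputable section

open scoped Classical

universe u

namespace WeierstrassCurve


variable {K : Type u} [Field K] (W : WeierstrassCurve K) (ℓ : ℕ) [Fact ℓ.Prime]

/-- **The named fact `det_galoisRepTate_frobenius W ℓ` from the Weil pairing** (*AEC* V.2.3.1,
`det(φ_ℓ) = q`, from Prop. III.8.1 on `E[ℓ^n]` for all `n ≥ 1`: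
`det_galoisRepTate_frobenius_of_exists_weilPairing` of `TateModuleDeterminantProofs`).
[cite: SilvermanAEC2009, Thm. V.2.3.1 (proof) with Prop. III.8.1] -/
theorem det_galoisRepTate_frobenius_of_exists_weilPairing'
    (hW : ∀ n : ℕ, W.exists_weilPairing (ℓ ^ (n + 1))) : W.det_galoisRepTate_frobenius ℓ :=
  fun hℓ _ hσ ↦ det_galoisRepTate_frobenius_of_exists_weilPairing W ℓ hℓ hW hσ

/-- **The named fact `det_galoisRepTate_frobenius W ℓ` along Silverman's route** (*AEC* V.2.3.1:
`det(φ_ℓ) = deg φ = q`, from Prop. III.8.6 = V.2.3 and Prop. II.2.11(c), the named facts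
`Isogeny.det_tateModule_map_eq_deg W ℓ` and `frobeniusIsogeny_deg_eq_card W` of
`FrobeniusEndomorphism`). [cite: SilvermanAEC2009, Thm. V.2.3.1 (proof)] -/
theorem det_galoisRepTate_frobenius_of_deg (h86 : Isogeny.det_tateModule_map_eq_deg W ℓ)
    (hdeg : W.frobeniusIsogeny_deg_eq_card) : W.det_galoisRepTate_frobenius ℓ :=
  fun hℓ _ hσ ↦ det_galoisRepTate_frobenius_of_facts W ℓ h86 hdeg hℓ hσ

/-- **The named fact `trace_galoisRepTate_frobenius W ℓ` along Silverman's route** (*AEC*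
V.2.3.1: `tr(φ_ℓ) = 1 + deg φ - deg(1 - φ) = 1 + q - #E(𝔽_q)`), from Prop. III.8.6 (`h86`),
Prop. II.2.11(c) (`hdeg`), Thm. III.4.10(a) (`h410`, named fact of `IsogenyDegree`) and
Cor. III.5.5 (`h55`) — `trace_galoisRepTate_frobenius_of_facts` of `FrobeniusEndomorphism`.
[cite: SilvermanAEC2009, Thm. V.2.3.1 (proof)] -/
theorem trace_galoisRepTate_frobenius_of_deg (h86 : Isogeny.det_tateModule_map_eq_deg W ℓ)
    (hdeg : W.frobeniusIsogeny_deg_eq_card) (h410 : Isogeny.card_ker_eq_finSepDegree W W)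
    (h55 : W.isSeparable_oneSubFrobeniusIsogeny) : W.trace_galoisRepTate_frobenius ℓ :=
  fun hℓ _ hσ ↦ trace_galoisRepTate_frobenius_of_facts W ℓ h86 hdeg h410 h55 hℓ hσ

/-- **The named fact `trace_galoisRepTate_frobenius W ℓ` from the Weil pairing, III.8.6 at
`1 - φ`, III.4.10(a) and III.5.5**: `tr(φ_ℓ) = 1 + det(φ_ℓ) - det(1 - φ_ℓ)`
(`trace_eq_one_add_det_sub_det`) with `det(φ_ℓ) = q` (Weil pairings `hW`, Prop. III.8.1, via
`det_galoisRepTate_frobenius_of_exists_weilPairing`) and `det(1 - φ_ℓ) = det(T_ℓ(1 - φ)) =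
deg(1 - φ)` (Prop. III.8.6, `h86`) `= #ker(1 - φ) = #E(k)` (Thm. III.4.10(a), `h410`, and
Cor. III.5.5, `h55`; `deg_oneSubFrobeniusIsogeny_eq_card_of_facts`) — Silverman's proofs of
Thm. V.1.1 and Thm. V.2.3.1 with Prop. II.2.11(c) replaced by Prop. III.8.1.
[cite: SilvermanAEC2009, Thm. V.2.3.1 (proof) and Thm. V.1.1 (proof)] -/
theorem trace_galoisRepTate_frobenius_of_exists_weilPairing
    (hW : ∀ n : ℕ, W.exists_weilPairing (ℓ ^ (n + 1)))
    (h86 : Isogeny.det_tateModule_map_eq_deg W ℓ) (h410 : Isogeny.card_ker_eq_finSepDegree W W)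
    (h55 : W.isSeparable_oneSubFrobeniusIsogeny) : W.trace_galoisRepTate_frobenius ℓ := by
  intro _ _ hℓ σ hσ
  rw [trace_eq_one_add_det_sub_det hℓ, det_galoisRepTate_frobenius_of_exists_weilPairing W ℓ hℓ hW hσ,
    ← tateModule_map_oneSubFrobeniusIsogeny W hσ ℓ, h86 hℓ,
    deg_oneSubFrobeniusIsogeny_eq_card_of_facts W h410 h55 hσ]
  ring

end WeierstrassCurve

/-! ## Part 2: the Weil pairing proved — `det(φ_ℓ) = q` unconditionally; `tr(φ_ℓ)` from III.8.6 alone -/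

namespace WeierstrassCurve

variable {K : Type u} [Field K] (W : WeierstrassCurve K) (ℓ : ℕ) [Fact ℓ.Prime]

/-- **Discharge of the named fact `det_galoisRepTate_frobenius W ℓ`** (Silverman, *AEC*,
Thm. V.2.3.1, the determinant: `det(φ_ℓ) = q` for the arithmetic Frobenius of a finite field on
`T_ℓ E`, `ℓ ≠ char k`): `det_galoisRepTate_frobenius_of_exists_weilPairing'` with the Weil
pairings on `E[ℓ^{n+1}]` now **proved** (`WeierstrassCurve.exists_weilPairing_holds`,
`Literature.NumberTheory.EllipticCurves.WeilPairingProofs`, *AEC* Prop. III.8.1).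
[cite: SilvermanAEC2009, Thm. V.2.3.1 (proof) with Prop. III.8.1] -/
theorem det_galoisRepTate_frobenius_holds : W.det_galoisRepTate_frobenius ℓ :=
  det_galoisRepTate_frobenius_of_exists_weilPairing' W ℓ fun _ ↦ W.exists_weilPairing_holds _

/-- **`det ρ_{E,ℓ} = χ_ℓ` on `T_ℓ E`, unconditionally** (`det_galoisRepTate_eq_cyclotomicCharacter`
of `TateModuleDeterminantProofs` with the Weil pairings proved): for an elliptic curve over a
perfect field `K`, a prime `ℓ ≠ char K` and `σ ∈ Γ_K`. Silverman, *AEC*, III.§8 (Prop. III.8.1,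
III.8.3); Cornell–Silverman–Stevens II.§7–8. [cite: SilvermanAEC2009, Prop. III.8.1 and Prop. III.8.3] -/
theorem det_galoisRepTate_eq_cyclotomicCharacter_holds [PerfectField K] [W.IsElliptic]
    (hℓ : (ℓ : K) ≠ 0) (σ : Field.absoluteGaloisGroup K) :
    LinearMap.det (W.galoisRepTate ℓ σ : W.tateModule ℓ →ₗ[ℤ_[ℓ]] W.tateModule ℓ) =
      ((Literature.NumberTheory.GaloisRepresentations.GaloisRep.cyclotomicCharacter K ℓ σ : ℤ_[ℓ]ˣ) : ℤ_[ℓ]) :=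
  det_galoisRepTate_eq_cyclotomicCharacter W ℓ hℓ (fun _ ↦ W.exists_weilPairing_holds _) σ

/-- **The named fact `trace_galoisRepTate_frobenius W ℓ` (`tr(φ_ℓ) = q + 1 - #E(k)`, Silverman
*AEC* Thm. V.2.3.1) from Prop. III.8.6 alone**: `trace_galoisRepTate_frobenius_of_exists_weilPairing`
with its other three inputs now proved in the tree — the Weil pairings
(`exists_weilPairing_holds`), Thm. III.4.10(a) (`Isogeny.card_ker_eq_finSepDegree_holds`,
`IsogenyDegreeKernelProofs`) and Cor. III.5.5 (`isSeparable_oneSubFrobeniusIsogeny_holds`,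
`FrobeniusSeparableProofs`); the remaining hypothesis is `Isogeny.det_tateModule_map_eq_deg W ℓ`
(`det T_ℓ(ψ) = deg ψ`, *AEC* Prop. III.8.6). [cite: SilvermanAEC2009, Thm. V.2.3.1 (proof) and Thm. V.1.1 (proof)] -/
theorem trace_galoisRepTate_frobenius_of_det_tateModule_map_eq_deg
    (h86 : Isogeny.det_tateModule_map_eq_deg W ℓ) : W.trace_galoisRepTate_frobenius ℓ :=
  trace_galoisRepTate_frobenius_of_exists_weilPairing W ℓ (fun _ ↦ W.exists_weilPairing_holds _) h86
    (Isogeny.card_ker_eq_finSepDegree_holds W W) W.isSeparable_oneSubFrobeniusIsogeny_holds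

end WeierstrassCurve
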